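import Summits.ValiantsHypothesis.ValiantsHypothesis.Theorems.LacunarySymmetroidMatrixDescartesPivotStaircaseAllKCalculus

/-!
# `MatrixDescartes` (stmt-ValiantsHypothesis-18050) — POLE WEAVING STACKED: the scalar model of the all-`(m, K)`
# arrowhead construction alternates `2ck + 2` times (`k` blocks, `c = K − 1` above letters per block)

HONEST FRAMING.  Cell `pub-symmetroid`, seat `val-sym-mdr-p2` (gen 24); helper file `--supports` the crux
`Theses.LacunarySymmetroid.MatrixDescartes` (OPEN), NO closure claim.  Pure one-variable real analysis: the soft induction of
the tree's arrowhead kits (`…WLawArrowKit`, `…PivotArrowSixKit`: a bounded block shape placed at separated scales) with the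
POLE-WEAVING block shape of `…PivotStaircaseAllKCalculus`, generic in the number `2c` of crossings per block:
`φ(y) = (Ã(y)/2 − y/16)/m(y)`, `Ã = Σ_{i<c} 8nᵢ y^{nᵢ−1}`, `m = 1/8 + y/4 + yÃ` (the Schur shape of a block with below letter
`1/8`, positive pivot entry `1/4`, above letters `8nᵢ` bordered against the hub); `2φ − 1 = G/(y m)` with
`G(y) = (1 − y)·Σ 8nᵢ y^{nᵢ} − y/8 − 3y²/8`, and `G` has the signs of the slack-free closed form `g` at the `2c` interior weaving
points (`block_neg`, `block_pos`).  MODEL `M(x) = x⁻¹ − 1 + Σ_{i<k} 2φ(x/Ξᵢ)`: for every `k` there are scales `Ξ` and `2ck + 1`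
increasing positive points with signs `+,−,…,+` (`model_alternates`), and with a slack `s x^T'` two more (`end_step`):
`2ck + 2 = 2(m−1)(K−1) + 2` sign changes at `m = k + 1`, `K = c + 1`.  The companion `…PivotBilinearAll` realises `M` as the
determinant of an index-one pivot pencil.  Nothing here bears on `MatrixDescartes` in its window, the upper pivot rungs,
`DoorA26`/`DoorA34`, the registers, `VP ≠ VNP`.
[folklore] Elementary real analysis over Mathlib (`Filter.eventually_all`, squeeze).
-/

set_option linter.dupNamespace false

namespace Summit.ValiantsHypothesis.ValiantsHypothesis.Theorems.LacunarySymmetroidMatrixDescartes.Pivot.PoleWeave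

open scoped BigOperators Topology
open Finset Filter

/-! ### Notation (local, no definitions) -/

/-- The scale `S = 2^{c+7}`. -/
local notation3 (prettyPrint := false) "S⟦" c "⟧" => (2 ^ (c + 7))

/-- The exponents `nᵢ = (S²)^{i+1}`. -/
local notation3 (prettyPrint := false) "n⟦" c ", " i "⟧" => ((S⟦c⟧ * S⟦c⟧) ^ (i + 1))

/-- The slack-free closed form `g(t) = (1 − t)·Σᵢ 8nᵢ t^{nᵢ} − t²`. -/
local notation3 (prettyPrint := false) "g⟦" c "⟧(" t ")" =>
  ((1 - t) * (∑ i : Fin c, (8 * (n⟦c, (i : ℕ)⟧ : ℝ)) * t ^ (n⟦c, (i : ℕ)⟧)) - t ^ 2)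

/-- The gaps `ω_j` of the interior weaving points. -/
local notation3 (prettyPrint := false) "ω⟦" c ", " j "⟧" =>
  (if j = 0 then ((1 : ℝ) / 2)
    else if j % 2 = 1 then (1 : ℝ) / (2 * (n⟦c, j / 2⟧ : ℝ))
    else (1 : ℝ) / ((S⟦c⟧ * n⟦c, j / 2 - 1⟧ : ℕ) : ℝ))

/-- `Ã(y) = Σ 8nᵢ y^{nᵢ−1}` (so that `y·Ã(y) = Σ 8nᵢ y^{nᵢ}`). -/
local notation3 (prettyPrint := false) "Ã⟦" c "⟧(" y ")" =>
  (∑ i : Fin c, (8 * (n⟦c, (i : ℕ)⟧ : ℝ)) * (y : ℝ) ^ (n⟦c, (i : ℕ)⟧ - 1))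

/-- The block's diagonal entry `m(y) = 1/8 + y/4 + y Ã(y)`. -/
local notation3 (prettyPrint := false) "m⟦" c "⟧(" y ")" => ((1 : ℝ) / 8 + (y : ℝ) / 4 + (y : ℝ) * Ã⟦c⟧(y))

/-- The block shape `φ(y) = (Ã(y)/2 − y/16)/m(y)`. -/
local notation3 (prettyPrint := false) "φ⟦" c "⟧(" y ")" => ((Ã⟦c⟧(y) / 2 - (y : ℝ) / 16) / m⟦c⟧(y))

/-- The block sign function `G(y) = (1 − y)Σ 8nᵢ y^{nᵢ} − y/8 − 3y²/8`. -/
local notation3 (prettyPrint := false) "G⟦" c "⟧(" y ")" =>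
  ((1 - y) * (∑ i : Fin c, (8 * (n⟦c, (i : ℕ)⟧ : ℝ)) * y ^ (n⟦c, (i : ℕ)⟧)) - y / 8 - 3 * y ^ 2 / 8)

/-- The stacked model `M(x) = x⁻¹ − 1 + Σᵢ 2 φ(x/Ξᵢ)`. -/
local notation3 (prettyPrint := false) "M⟦" c ", " Ξ "⟧(" x ")" =>
  ((x : ℝ)⁻¹ - 1 + ∑ i, 2 * φ⟦c⟧((x : ℝ) / (Ξ : Fin _ → ℝ) i))

/-! ### 1. The block: `2φ − 1` has the signs of `G`, and `G` the signs of `g` -/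

/-- `y Ã(y) = Σ 8nᵢ y^{nᵢ}`. -/
theorem mul_A (c : ℕ) (y : ℝ) :
    y * Ã⟦c⟧(y) = ∑ i : Fin c, (8 * (n⟦c, (i : ℕ)⟧ : ℝ)) * y ^ (n⟦c, (i : ℕ)⟧) := by
  rw [Finset.mul_sum]
  refine Finset.sum_congr rfl fun i _ => ?_
  have h1 : 1 ≤ n⟦c, (i : ℕ)⟧ := one_le_n c i
  calc y * ((8 * (n⟦c, (i : ℕ)⟧ : ℝ)) * y ^ (n⟦c, (i : ℕ)⟧ - 1))
      = (8 * (n⟦c, (i : ℕ)⟧ : ℝ)) * (y ^ (n⟦c, (i : ℕ)⟧ - 1) * y) := by ring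
    _ = (8 * (n⟦c, (i : ℕ)⟧ : ℝ)) * y ^ (n⟦c, (i : ℕ)⟧) := by rw [← pow_succ, Nat.sub_add_cancel h1]

/-- `Ã ≥ 0` on `[0, ∞)`. -/
theorem A_nonneg (c : ℕ) {y : ℝ} (hy : 0 ≤ y) : 0 ≤ Ã⟦c⟧(y) :=
  Finset.sum_nonneg fun i _ => by positivity

/-- `m > 0` on `[0, ∞)`. -/
theorem m_pos (c : ℕ) {y : ℝ} (hy : 0 ≤ y) : 0 < m⟦c⟧(y) := by
  have := A_nonneg c hy
  positivity

/-- The sign transfer: `y m(y) (2 φ(y) − 1) = G(y)`. -/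
theorem block_eq (c : ℕ) {y : ℝ} (hy : 0 ≤ y) :
    y * m⟦c⟧(y) * (2 * φ⟦c⟧(y) - 1) = G⟦c⟧(y) := by
  have hm := (m_pos c hy).ne'
  rw [← mul_A c y]
  field_simp
  ring

/-- `G ≥ g` on `[1/5, ∞)` (the target `y/8 + 3y²/8` is below `y²` there). -/
theorem g_le_G (c : ℕ) {y : ℝ} (hy : (1 : ℝ) / 5 ≤ y) : g⟦c⟧(y) ≤ G⟦c⟧(y) := by
  nlinarith

/-- **Block peaks**: `2φ(y) − 1 > 0` at the peaks `y = 1 − ω_{2i+1} = 1 − 1/(2nᵢ)`, `i < c`. -/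
theorem block_pos (c i : ℕ) (hi : i < c) : 0 < 2 * φ⟦c⟧(1 - ω⟦c, 2 * i + 1⟧) - 1 := by
  have hg := g_odd_pos c i hi
  rw [ω_odd] at hg ⊢
  set y : ℝ := 1 - 1 / (2 * (n⟦c, i⟧ : ℝ)) with hy
  have hn : (1 : ℝ) ≤ (n⟦c, i⟧ : ℝ) := by exact_mod_cast one_le_n c i
  have hy5 : (1 : ℝ) / 5 ≤ y := by
    rw [hy]
    have : 1 / (2 * (n⟦c, i⟧ : ℝ)) ≤ 1 / 2 := by
      apply div_le_div_of_nonneg_left (by norm_num) (by norm_num); linarith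
    linarith
  have hy0 : 0 ≤ y := by linarith
  have hG : 0 < G⟦c⟧(y) := lt_of_lt_of_le hg (g_le_G c hy5)
  rw [← block_eq c hy0] at hG
  have hym : 0 < y * m⟦c⟧(y) := mul_pos (by linarith) (m_pos c hy0)
  exact pos_of_mul_pos_right hG hym.le

/-- **Block valleys**: `2φ(y) − 1 < 0` at `y = 1 − ω_{2i}` (`y = 1/2` and `y = 1 − 1/(S nᵢ)`). -/
theorem block_neg (c i : ℕ) : 2 * φ⟦c⟧(1 - ω⟦c, 2 * i⟧) - 1 < 0 := by
  have hfrac := frac_lt_eighth c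
  -- the point and the bump bound there
  obtain ⟨y, hyeq, hy2, hy1, hb⟩ : ∃ y : ℝ, 1 - ω⟦c, 2 * i⟧ = y ∧ (1 : ℝ) / 2 ≤ y ∧ y ≤ 1 ∧
      (1 - y) * (∑ j : Fin c, (8 * (n⟦c, (j : ℕ)⟧ : ℝ)) * y ^ (n⟦c, (j : ℕ)⟧)) ≤ (c : ℝ) * (1 / (8 * ((c : ℝ) + 1))) := by
    rcases i with _ | i
    · refine ⟨1 / 2, ?_, by norm_num, by norm_num, bumps_half_le c⟩
      rw [show (2 * 0 : ℕ) = 0 from rfl, ω_zero]; norm_num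
    · obtain ⟨h1, h2⟩ := half_le_valley c i
      refine ⟨_, ?_, h1, h2, bumps_valley_le c i⟩
      rw [show 2 * (i + 1) = 2 * i + 2 by ring, ω_even]
  rw [hyeq]
  have hy0 : 0 ≤ y := by linarith
  have hG : G⟦c⟧(y) < 0 := by nlinarith
  rw [← block_eq c hy0] at hG
  have hym : 0 < y * m⟦c⟧(y) := mul_pos (by linarith) (m_pos c hy0)
  by_contra h
  exact absurd hG (not_lt.2 (mul_nonneg hym.le (not_lt.1 h)))

/-! ### 2. Limits of the block shape and of the model -/

/-- `φ(y) → 0` as `y → 0` (`φ` is continuous at `0`, `m(0) = 1/8 ≠ 0`, `φ(0) = 0`). -/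
theorem phi_tendsto_zero (c : ℕ) : Tendsto (fun y : ℝ => φ⟦c⟧(y)) (𝓝 0) (𝓝 0) := by
  have hnum : Continuous fun y : ℝ => Ã⟦c⟧(y) / 2 - y / 16 :=
    ((continuous_finsetSum _ fun i _ => (continuous_const.mul (continuous_pow _))).div_const _).sub
      (continuous_id.div_const _)
  have hden : Continuous fun y : ℝ => m⟦c⟧(y) :=
    (continuous_const.add (continuous_id.div_const _)).add
      (continuous_id.mul (continuous_finsetSum _ fun i _ => (continuous_const.mul (continuous_pow _))))
  have h0 : m⟦c⟧((0 : ℝ)) ≠ 0 := (m_pos c le_rfl).ne'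
  have hat := (hnum.continuousAt (x := 0)).div (hden.continuousAt (x := 0)) h0
  have hval : φ⟦c⟧((0 : ℝ)) = 0 := by
    have hA : Ã⟦c⟧((0 : ℝ)) = 0 := by
      refine Finset.sum_eq_zero fun i _ => ?_
      have h2 : 1 ≤ n⟦c, (i : ℕ)⟧ - 1 := by
        have := SS_le_n c i
        have h4 : 2 ≤ (S⟦c⟧ * S⟦c⟧ : ℕ) := Nat.le_mul_of_pos_left _ (one_le_S c) |>.trans' (by
          have := S_ge c; omega)
        omega
      rw [zero_pow (by omega), mul_zero]
    rw [hA]; norm_num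
  have h2 : Tendsto (fun y : ℝ => φ⟦c⟧(y)) (𝓝 0) (𝓝 (φ⟦c⟧((0 : ℝ)))) := hat.tendsto
  rwa [hval] at h2

/-- `φ(y) → 0` as `y → ∞`: for `y ≥ 1`, `|φ(y)| ≤ 1/y` (`c ≥ 1`: `Ã(y) ≥ 8y`). -/
theorem phi_tendsto_atTop (c : ℕ) (hc : 1 ≤ c) : Tendsto (fun y : ℝ => φ⟦c⟧(y)) atTop (𝓝 0) := by
  have hup : ∀ y : ℝ, 1 ≤ y → φ⟦c⟧(y) ≤ y⁻¹ := by
    intro y hy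
    have hy0 : 0 < y := by linarith
    have hA0 : 0 ≤ Ã⟦c⟧(y) := A_nonneg c hy0.le
    have hm : 0 < m⟦c⟧(y) := m_pos c hy0.le
    rw [div_le_iff₀ hm]
    have : y⁻¹ * m⟦c⟧(y) = y⁻¹ / 8 + 1 / 4 + Ã⟦c⟧(y) := by field_simp
    rw [this]
    have : 0 < y⁻¹ := by positivity
    linarith
  have hlow : ∀ y : ℝ, 1 ≤ y → -y⁻¹ ≤ φ⟦c⟧(y) := by
    intro y hy
    have hy0 : 0 < y := by linarith
    have hm : 0 < m⟦c⟧(y) := m_pos c hy0.le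
    have hA8 : 8 * y ≤ Ã⟦c⟧(y) := by
      have hsingle := Finset.single_le_sum (s := (Finset.univ : Finset (Fin c)))
        (f := fun i : Fin c => (8 * (n⟦c, (i : ℕ)⟧ : ℝ)) * y ^ (n⟦c, (i : ℕ)⟧ - 1))
        (fun i _ => by positivity) (Finset.mem_univ ⟨0, hc⟩)
      have hn1 : (1 : ℝ) ≤ (n⟦c, 0⟧ : ℝ) := by exact_mod_cast one_le_n c 0
      have hn2 : 1 ≤ n⟦c, 0⟧ - 1 := by
        have := SS_le_n c 0
        have h4 : 2 ≤ (S⟦c⟧ * S⟦c⟧ : ℕ) := Nat.le_mul_of_pos_left _ (one_le_S c) |>.trans' (by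
          have := S_ge c; omega)
        omega
      have hpow : y ≤ y ^ (n⟦c, 0⟧ - 1) := by
        calc y = y ^ 1 := (pow_one y).symm
          _ ≤ y ^ (n⟦c, 0⟧ - 1) := pow_le_pow_right₀ hy hn2
      have h8 : 8 * y ≤ (8 * (n⟦c, 0⟧ : ℝ)) * y ^ (n⟦c, 0⟧ - 1) := by
        calc 8 * y = (8 * 1) * y := by ring
          _ ≤ (8 * (n⟦c, 0⟧ : ℝ)) * y ^ (n⟦c, 0⟧ - 1) := mul_le_mul (by linarith) hpow hy0.le (by positivity)
      exact h8.trans (by simpa using hsingle)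
    rw [le_div_iff₀ hm]
    have hid : y⁻¹ * m⟦c⟧(y) = y⁻¹ / 8 + 1 / 4 + Ã⟦c⟧(y) := by field_simp
    rw [neg_mul, hid]
    have : 0 < y⁻¹ := by positivity
    nlinarith
  have h1 : Tendsto (fun y : ℝ => y⁻¹) atTop (𝓝 0) := tendsto_inv_atTop_zero
  have h2 : Tendsto (fun y : ℝ => -y⁻¹) atTop (𝓝 0) := by simpa using h1.neg
  refine tendsto_of_tendsto_of_tendsto_of_le_of_le' h2 h1 ?_ ?_
  · filter_upwards [eventually_ge_atTop (1 : ℝ)] with y hy using hlow y hy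
  · filter_upwards [eventually_ge_atTop (1 : ℝ)] with y hy using hup y hy

/-- As `x → ∞` the model tends to `−1`. -/
theorem model_tendsto_atTop (c : ℕ) (hc : 1 ≤ c) {k : ℕ} (Ξ : Fin k → ℝ) (hΞ : ∀ i, 0 < Ξ i) :
    Tendsto (fun x : ℝ => M⟦c, Ξ⟧(x)) atTop (𝓝 (-1)) := by
  have h1 : Tendsto (fun x : ℝ => x⁻¹) atTop (𝓝 0) := tendsto_inv_atTop_zero
  have h2 : ∀ i, Tendsto (fun x : ℝ => 2 * φ⟦c⟧(x / Ξ i)) atTop (𝓝 (2 * 0)) := fun i =>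
    ((phi_tendsto_atTop c hc).comp (tendsto_id.atTop_div_const (hΞ i))).const_mul 2
  have h3 : Tendsto (fun x : ℝ => ∑ i, 2 * φ⟦c⟧(x / Ξ i)) atTop (𝓝 (∑ i : Fin k, 2 * (0 : ℝ))) :=
    tendsto_finsetSum _ fun i _ => h2 i
  have := (h1.sub_const 1).add h3
  convert this using 2
  simp

/-- At a fixed point `x`, the contribution of a new block of scale `Ξ' → ∞` vanishes. -/
theorem tendsto_newBlock_zero (c : ℕ) (x : ℝ) :
    Tendsto (fun Ξ' : ℝ => 2 * φ⟦c⟧(x / Ξ')) atTop (𝓝 0) := by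
  have h : Tendsto (fun Ξ' : ℝ => x / Ξ') atTop (𝓝 0) := tendsto_id.const_div_atTop x
  simpa using ((phi_tendsto_zero c).comp h).const_mul 2

/-- At a new point `y·Ξ'` (`y > 0` fixed, `Ξ' → ∞`) the old model tends to `−1`. -/
theorem tendsto_model_newPoint (c : ℕ) (hc : 1 ≤ c) {k : ℕ} (Ξ : Fin k → ℝ) (hΞ : ∀ i, 0 < Ξ i)
    {y : ℝ} (hy : 0 < y) : Tendsto (fun Ξ' : ℝ => M⟦c, Ξ⟧(y * Ξ')) atTop (𝓝 (-1)) :=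
  (model_tendsto_atTop c hc Ξ hΞ).comp (tendsto_id.const_mul_atTop hy)

/-- Adding a block: the model with `snoc`-extended scales is the old model plus `2 φ(x/Ξ')`. -/
theorem model_snoc (c : ℕ) {k : ℕ} (Ξ : Fin k → ℝ) (Ξ' x : ℝ) :
    M⟦c, Fin.snoc Ξ Ξ'⟧(x) = M⟦c, Ξ⟧(x) + 2 * φ⟦c⟧(x / Ξ') := by
  simp only [Fin.sum_univ_castSucc, Fin.snoc_castSucc, Fin.snoc_last]
  ring

/-! ### 3. The induction: `2ck + 1` alternating points for `k` blocks -/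

/-- **The stacked model alternates.**  For every `k` there are positive scales `Ξ : Fin k → ℝ` and positive points
`t 0 < t 1 < ⋯ < t (2ck)` with `(−1)^j M(t j) > 0` (`+` at even, `−` at odd positions). -/
theorem model_alternates (c : ℕ) (hc : 1 ≤ c) (k : ℕ) :
    ∃ (Ξ : Fin k → ℝ) (t : ℕ → ℝ), (∀ i, 0 < Ξ i) ∧ (∀ j, j ≤ 2 * c * k → 0 < t j) ∧
      (∀ j, j < 2 * c * k → t j < t (j + 1)) ∧
      (∀ j, j ≤ 2 * c * k → 0 < (-1 : ℝ) ^ j * M⟦c, Ξ⟧(t j)) := by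
  induction k with
  | zero =>
    refine ⟨Fin.elim0, fun _ => 1 / 2, fun i => i.elim0, fun j _ => by norm_num, fun j hj => by omega, fun j hj => ?_⟩
    have hj0 : j = 0 := by omega
    subst hj0
    norm_num
  | succ k ih =>
    obtain ⟨Ξ, t, hΞ, hpos, hmono, hsign⟩ := ih
    have E1 : ∀ j : Fin (2 * c * k + 1), ∀ᶠ Ξ' : ℝ in atTop,
        0 < (-1 : ℝ) ^ (j : ℕ) * (M⟦c, Ξ⟧(t j) + 2 * φ⟦c⟧(t j / Ξ')) := by
      intro j
      have ht : Tendsto (fun Ξ' : ℝ => (-1 : ℝ) ^ (j : ℕ) * (M⟦c, Ξ⟧(t j) + 2 * φ⟦c⟧(t j / Ξ')))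
          atTop (𝓝 ((-1 : ℝ) ^ (j : ℕ) * (M⟦c, Ξ⟧(t j) + 0))) :=
        ((tendsto_newBlock_zero c (t j)).const_add _).const_mul _
      rw [add_zero] at ht
      exact ht.eventually_const_lt (hsign j (by omega))
    have E2 : ∀ l : Fin (2 * c), ∀ᶠ Ξ' : ℝ in atTop,
        0 < (-1 : ℝ) ^ ((l : ℕ) + 1) * (M⟦c, Ξ⟧((1 - ω⟦c, (l : ℕ)⟧) * Ξ') + 2 * φ⟦c⟧((1 - ω⟦c, (l : ℕ)⟧) * Ξ' / Ξ')) := by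
      intro l
      have hy : 0 < 1 - ω⟦c, (l : ℕ)⟧ := by have := ω_lt_one c l; linarith
      have ht : Tendsto (fun Ξ' : ℝ => (-1 : ℝ) ^ ((l : ℕ) + 1) *
            (M⟦c, Ξ⟧((1 - ω⟦c, (l : ℕ)⟧) * Ξ') + 2 * φ⟦c⟧((1 - ω⟦c, (l : ℕ)⟧) * Ξ' / Ξ')))
          atTop (𝓝 ((-1 : ℝ) ^ ((l : ℕ) + 1) * (-1 + 2 * φ⟦c⟧(1 - ω⟦c, (l : ℕ)⟧)))) := by
        refine (((tendsto_model_newPoint c hc Ξ hΞ hy).add_const _).const_mul _).congr' ?_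
        filter_upwards [eventually_gt_atTop (0 : ℝ)] with Ξ' hΞ'
        rw [mul_div_cancel_right₀ _ hΞ'.ne']
      refine ht.eventually_const_lt ?_
      obtain ⟨i, hi | hi⟩ := Nat.even_or_odd' (l : ℕ)
      · have hb := block_neg c i
        rw [hi]
        generalize φ⟦c⟧(1 - ω⟦c, 2 * i⟧) = P at hb ⊢
        rw [pow_succ, pow_mul]
        norm_num
        linarith
      · have hb := block_pos c i (by omega)
        rw [hi]
        generalize φ⟦c⟧(1 - ω⟦c, 2 * i + 1⟧) = P at hb ⊢
        rw [show 2 * i + 1 + 1 = 2 * (i + 1) by ring, pow_mul]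
        norm_num
        linarith
    obtain ⟨Ξ', ⟨hE1, hE2⟩, hbig, hΞ'pos⟩ :=
      (((eventually_all.2 E1).and (eventually_all.2 E2)).and
        ((eventually_gt_atTop (2 * t (2 * c * k))).and (eventually_gt_atTop (0 : ℝ)))).exists
    refine ⟨Fin.snoc Ξ Ξ', fun j => if j ≤ 2 * c * k then t j else (1 - ω⟦c, j - (2 * c * k + 1)⟧) * Ξ',
      ?_, ?_, ?_, ?_⟩
    · intro i
      refine Fin.lastCases ?_ (fun i => ?_) i
      · simpa using hΞ'pos
      · simpa using hΞ i
    · intro j hj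
      dsimp only
      by_cases hjk : j ≤ 2 * c * k
      · rw [if_pos hjk]; exact hpos j hjk
      · rw [if_neg hjk]
        have := ω_lt_one c (j - (2 * c * k + 1))
        exact mul_pos (by linarith) hΞ'pos
    · intro j hj
      dsimp only
      by_cases hjk : j + 1 ≤ 2 * c * k
      · rw [if_pos (by omega), if_pos hjk]; exact hmono j (by omega)
      · by_cases hjk' : j ≤ 2 * c * k
        · -- `j = 2ck`: `t (2ck) < (1 − ω₀) Ξ' = Ξ'/2`
          have hj' : j = 2 * c * k := by omega
          rw [if_pos hjk', if_neg hjk, hj', show 2 * c * k + 1 - (2 * c * k + 1) = 0 by omega, ω_zero]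
          linarith [hpos (2 * c * k) le_rfl]
        · rw [if_neg hjk', if_neg hjk, show j + 1 - (2 * c * k + 1) = (j - (2 * c * k + 1)) + 1 by omega]
          have := ω_succ_lt c (j - (2 * c * k + 1)) (by
            have : 2 * c * (k + 1) = 2 * c * k + 2 * c := by ring
            omega)
          nlinarith
    · intro j hj
      dsimp only
      by_cases hjk : j ≤ 2 * c * k
      · rw [if_pos hjk, model_snoc]
        exact hE1 ⟨j, by omega⟩
      · obtain ⟨r, rfl⟩ : ∃ r, j = 2 * c * k + 1 + r := ⟨j - (2 * c * k + 1), by omega⟩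
        have hr : 2 * c * k + 1 + r - (2 * c * k + 1) = r := Nat.add_sub_cancel_left _ _
        rw [if_neg hjk, model_snoc, hr]
        have hl : r < 2 * c := by
          have : 2 * c * (k + 1) = 2 * c * k + 2 * c := by ring
          omega
        have h := hE2 ⟨r, hl⟩
        have hpar : (-1 : ℝ) ^ (2 * c * k + 1 + r) = (-1 : ℝ) ^ (r + 1) := by
          rw [show 2 * c * k + 1 + r = (r + 1) + 2 * (c * k) by ring, pow_add, pow_mul]
          norm_num
        rw [hpar]
        exact h

/-! ### 4. The end: one more sign change from `M → −1`, one more from the slack -/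

/-- **End step.**  From the alternating data of `model_alternates` (last sign `+`), a far point where `M < 0`, then a
slack `s > 0` small enough to keep all signs, then a farther point where `M + s x^T > 0`: `2ck + 3` increasing positive
points along which `M(x) + s x^T` alternates `+,−,…,−,+` (`T ≥ 1`). -/
theorem end_step (c : ℕ) (hc : 1 ≤ c) {k : ℕ} (T : ℕ) (hT : 1 ≤ T) (Ξ : Fin k → ℝ) (hΞ : ∀ i, 0 < Ξ i)
    (t : ℕ → ℝ) (hpos : ∀ j, j ≤ 2 * c * k → 0 < t j) (hmono : ∀ j, j < 2 * c * k → t j < t (j + 1))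
    (hsign : ∀ j, j ≤ 2 * c * k → 0 < (-1 : ℝ) ^ j * M⟦c, Ξ⟧(t j)) :
    ∃ (s : ℝ) (u : ℕ → ℝ), 0 < s ∧ (∀ j, j ≤ 2 * c * k + 2 → 0 < u j) ∧
      (∀ j, j < 2 * c * k + 2 → u j < u (j + 1)) ∧
      (∀ j, j ≤ 2 * c * k + 2 → 0 < (-1 : ℝ) ^ j * (M⟦c, Ξ⟧(u j) + s * u j ^ T)) := by
  set N := 2 * c * k with hN
  obtain ⟨X₁, hX₁M, hX₁t⟩ : ∃ X₁ : ℝ, M⟦c, Ξ⟧(X₁) < -1 / 2 ∧ t N < X₁ :=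
    (((model_tendsto_atTop c hc Ξ hΞ).eventually_lt_const (by norm_num : (-1 : ℝ) < -1 / 2)).and
      (eventually_gt_atTop (t N))).exists
  have hX₁pos : 0 < X₁ := (hpos N le_rfl).trans hX₁t
  have E1 : ∀ j : Fin (N + 1), ∀ᶠ s : ℝ in 𝓝 0, 0 < (-1 : ℝ) ^ (j : ℕ) * (M⟦c, Ξ⟧(t j) + s * t j ^ T) := by
    intro j
    have ht : Tendsto (fun s : ℝ => (-1 : ℝ) ^ (j : ℕ) * (M⟦c, Ξ⟧(t j) + s * t j ^ T)) (𝓝 0)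
        (𝓝 ((-1 : ℝ) ^ (j : ℕ) * (M⟦c, Ξ⟧(t j) + 0 * t j ^ T))) :=
      ((tendsto_id.mul_const _).const_add _).const_mul _
    rw [zero_mul, add_zero] at ht
    exact ht.eventually_const_lt (hsign j (by omega))
  have E2 : ∀ᶠ s : ℝ in 𝓝 0, M⟦c, Ξ⟧(X₁) + s * X₁ ^ T < 0 := by
    have ht : Tendsto (fun s : ℝ => M⟦c, Ξ⟧(X₁) + s * X₁ ^ T) (𝓝 0) (𝓝 (M⟦c, Ξ⟧(X₁) + 0 * X₁ ^ T)) :=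
      (tendsto_id.mul_const _).const_add _
    rw [zero_mul, add_zero] at ht
    exact ht.eventually_lt_const (by linarith)
  obtain ⟨s, ⟨hsE1, hsE2⟩, hspos⟩ : ∃ s : ℝ, ((∀ j : Fin (N + 1), 0 < (-1 : ℝ) ^ (j : ℕ) *
      (M⟦c, Ξ⟧(t j) + s * t j ^ T)) ∧ M⟦c, Ξ⟧(X₁) + s * X₁ ^ T < 0) ∧ 0 < s := by
    have h := ((eventually_all.2 E1).and E2)
    have hpos' : ∀ᶠ s : ℝ in 𝓝[>] 0, 0 < s := eventually_mem_nhdsWithin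
    have h' : ∀ᶠ s : ℝ in 𝓝[>] 0, ((∀ j : Fin (N + 1), 0 < (-1 : ℝ) ^ (j : ℕ) *
        (M⟦c, Ξ⟧(t j) + s * t j ^ T)) ∧ M⟦c, Ξ⟧(X₁) + s * X₁ ^ T < 0) ∧ 0 < s :=
      (h.filter_mono nhdsWithin_le_nhds).and hpos'
    exact h'.exists
  obtain ⟨X₂, hX₂M, hX₂X⟩ : ∃ X₂ : ℝ, 0 < M⟦c, Ξ⟧(X₂) + s * X₂ ^ T ∧ X₁ < X₂ := by
    have h1 : Tendsto (fun x : ℝ => s * x ^ T) atTop atTop :=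
      (tendsto_pow_atTop (by omega)).const_mul_atTop hspos
    have h2 : Tendsto (fun x : ℝ => M⟦c, Ξ⟧(x) + s * x ^ T) atTop atTop :=
      (model_tendsto_atTop c hc Ξ hΞ).add_atTop h1
    exact ((h2.eventually_gt_atTop 0).and (eventually_gt_atTop X₁)).exists
  refine ⟨s, fun j => if j ≤ N then t j else if j = N + 1 then X₁ else X₂, hspos, ?_, ?_, ?_⟩
  · intro j hj
    dsimp only
    by_cases h1 : j ≤ N
    · rw [if_pos h1]; exact hpos j h1
    · by_cases h2 : j = N + 1
      · rw [if_neg h1, if_pos h2]; exact hX₁pos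
      · rw [if_neg h1, if_neg h2]; exact hX₁pos.trans hX₂X
  · intro j hj
    dsimp only
    by_cases h1 : j + 1 ≤ N
    · rw [if_pos (by omega), if_pos h1]; exact hmono j (by omega)
    · by_cases h2 : j ≤ N
      · rw [if_pos h2, if_neg h1, if_pos (by omega), show j = N by omega]; exact hX₁t
      · rw [if_neg h2, if_pos (by omega), if_neg (by omega), if_neg (by omega)]; exact hX₂X
  · intro j hj
    dsimp only
    by_cases h1 : j ≤ N
    · rw [if_pos h1]; exact hsE1 ⟨j, by omega⟩
    · by_cases h2 : j = N + 1
      · rw [if_neg h1, if_pos h2, h2, pow_succ, show N = 2 * (c * k) by rw [hN]; ring, pow_mul]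
        norm_num
        linarith
      · have hj' : j = N + 2 := by omega
        rw [if_neg h1, if_neg h2, hj', show N + 2 = 2 * (c * k + 1) by rw [hN]; ring, pow_mul]
        norm_num
        exact hX₂M

end Summit.ValiantsHypothesis.ValiantsHypothesis.Theorems.LacunarySymmetroidMatrixDescartes.Pivot.PoleWeave
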